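import Summits.BirchSwinnertonDyer.BirchSwinnertonDyer.Theses.GenusKolyvaginAtTwo
import Literature.NumberTheory.EllipticCurves.McCallum1991.DivisibilityDescent
import Summits.BirchSwinnertonDyer.Uniform.U2.RingClassNoTwoTorsion
import Literature.NumberTheory.EllipticCurves.TwoAdicImageSurjectivityModTwoProofs
import Literature.NumberTheory.QuadraticFields.QuadraticDedekindZeta

/-!
# Route `GenusKolyvaginAtTwo`, crux `KolyvaginExactAtTwo` (stmt-BirchSwinnertonDyer-22137): the crux
# in the `E(K)`-currency of the Heegner index, modulo Gross's Lemma 4.3 at `2` (glue, PROVED)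

Helper for crux #3 `KolyvaginExactAtTwo` (registered skeleton `Lines/birth`: `stub_upperBoundAtTwo`,
`stub_lowerBoundAtTwo` → `KolyvaginExactAtTwo_of`; seat `bsd-line-gk2-p3`). The crux types the
exponent `M₀` of `y_K` McCallum's way, by `2`-divisibility of `P(1) = d₁.derivedPoint` in
`E(K[1])` (`K[1]` = Hilbert class field). Every `2`-adic consumer in the tree speaks instead of the
Heegner point `y_K ∈ E(K)` and its index/divisibility in `E(K)`: Kolyvagin's Theorem B₂
(`Kolyvagin1989_theoremB_two`: `[E(K) : ℤP] · Ш(E/ℚ)[2^∞] = 0`), the Heegner-index door of class X5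
at `2` (`Rank1Residual/X5/HeegnerIndexDoorAtTwo.lean`: certificates `2^{k+1} ∤ [E(K) : ℤP]`), and
Gross–Zagier V.(2.2) (`#Ш(E/K) = ([E(K):ℤy_K]/(c∏m_q))²`, the discharge route of crux #4's
valuation stub). McCallum's Lemma 5.1 — `M_0 = ord_p[E(K):ℤy_K] = max{M : y_K ∈ p^M E(K_1)}`,
*"since `E(K_1)` has no `p`-torsion"* — is now a tree theorem modulo that torsion input
(`McCallum1991.pow_smul_exact_derivedPoint_one_iff`, file
`Literature/…/McCallum1991/DivisibilityDescent.lean`), so the crux can be READ in the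
`E(K)`-currency granted `E(K[1])[2] = 0` (Gross 1991, Lemma 4.3 at `p = 2`: true under the crux's
`2`-adic surjectivity and (H2) exclusions — `E(K_n)[2] ≠ 0` would put `ℚ(E[2])` inside the
generalised-dihedral field `K_n`, forcing `ℚ(√Δ) = K`, excluded by `d_K·(−|Δ|) ∉ ℚ^{×2}` — but not
proved in the tree, which lacks the dihedral structure of `Gal(K_n/ℚ)`; it is the displayed
hypothesis `htors`). Both theorems take the crux (`hX`, a registered route obligation) as a
hypothesis; nothing is claimed unconditionally; no named fact enters. BSD is not proved by any of this.

* `card_sha_two_eq_of_kolyvaginExactAtTwo_indexCurrency` — `hX` + crux hypotheses + `E(K[1])[2] = 0`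
  + `y₀ ∈ E(K)` over `P(1)` with `2^{M₀} ∥ y₀` IN `E(K)` + a level-`n` certificate ⟹
  `#Ш(E_K/K)[2^∞] = 4^{M₀}`;
* `card_sha_two_eq_one_of_kolyvaginExactAtTwo_indexCurrency` — the level-one instance: `y₀ ∉ 2E(K)`
  ⟹ `#Ш(E_K/K)[2^∞] = 1` (the shape in which W. Zhang-type `2`-primitivity — crux #6's foreseen
  input — is stated).

References: [McCallumLMS1991] §5 Lemma 5.1 (p. 303), §1 Theorem; [GrossLMS1991] §4 (4.1), Lemma 4.3;
[Kolyvagin1989Izv] Thm. B_l (l = 2); [GrossZagier1986] V.(2.2).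
-/

-- D-0017: single-problem summit, so `Summit.BirchSwinnertonDyer.BirchSwinnertonDyer.…` repeats a
-- namespace BY DESIGN.
set_option linter.dupNamespace false

noncomputable section

open scoped Classical

namespace Summit.BirchSwinnertonDyer.BirchSwinnertonDyer.Theorems

open Literature.NumberTheory.EllipticCurves Literature.NumberTheory.EllipticCurves.ModularForms
open Literature.NumberTheory.EllipticCurves.McCallum1991
open Summit.BirchSwinnertonDyer.BirchSwinnertonDyer.Theses.GenusKolyvaginAtTwo (KolyvaginExactAtTwo)

/-- **`KolyvaginExactAtTwo` read in the `E(K)`-currency (modulo Gross's Lemma 4.3 at `2`).** Granted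
the crux (`hX`): for `W/ℚ` globally minimal non-CM with `ρ_{E,2^n}` onto for all `n ≥ 1`, `K`
imaginary quadratic with odd `d_K ≠ -3`, Heegner hypothesis and the two (H2) non-square conditions,
a frame `(Dt, β, ι)` with conductor-`1` datum `d₁` of infinite order, NO `2`-torsion in `E(K[1])`
(`htors`, Gross's Lemma 4.3 at `2`), a point `y₀ ∈ E(K)` mapping to `P(1) = d₁.derivedPoint` (it
exists: `McCallum1991.exists_map_eq_derivedPoint_one'`) with `2^{M₀} ∣ y₀` and `2^{M₀+1} ∤ y₀` IN
`E(K)`, and a square-free level `n` of Kolyvagin primes at `2` with `P(n) ∉ 2E(K[n])`: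
`#Ш(E_K/K)[2^∞] = 2^{2M₀}`. (McCallum's Lemma 5.1 moves the exponent from `E(K)` to `E(K[1])`:
`McCallum1991.pow_smul_exact_derivedPoint_one_iff`; then the crux.)
[cite: McCallumLMS1991, §5 Lemma 5.1 (p. 303) and §1 Theorem (Kolyvagin)] [cite: GrossLMS1991, §4 Lemma 4.3] -/
theorem card_sha_two_eq_of_kolyvaginExactAtTwo_indexCurrency (hX : KolyvaginExactAtTwo)
    (W : WeierstrassCurve ℚ) [W.IsElliptic] [W.IsGloballyMinimal] [NeZero (W.conductorNorm ℤ)]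
    (hcm : ¬ W.HasCM) (K : Type) [Field K] [NumberField K] (hK : IsImaginaryQuadratic K)
    (hodd : Odd (NumberField.discr K)) (h3 : NumberField.discr K ≠ -3)
    (hH : SatisfiesHeegnerHypothesis (W.conductorNorm ℤ) K)
    (hΔ₁ : ¬ IsSquare ((NumberField.discr K : ℚ) * -|W.Δ|))
    (hΔ₂ : ¬ IsSquare ((NumberField.discr K : ℚ) * (-(2 * |W.Δ|))))
    (hρ : ∀ n : ℕ, 0 < n → W.HasSurjectiveModNGaloisRep ((2 : ℤ) ^ n))
    (Dt : ModularParametrizationData W (W.conductorNorm ℤ)) (β : ℤ) (ι : K →+* ℂ)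
    (d₁ : KolyvaginHeegnerData Dt β ι 1) (hy : ¬ IsOfFinAddOrder d₁.derivedPoint)
    (htors : ∀ T : (W.baseChange (ringClassField K ι 1)).toAffine.Point, (2 : ℤ) • T = 0 → T = 0)
    {y₀ : (W.baseChange K).toAffine.Point}
    (hy₀ : WeierstrassCurve.Affine.Point.map (algebraMap K (ringClassField K ι 1)).toRatAlgHom y₀ =
      d₁.derivedPoint)
    (M₀ : ℕ) (hdiv : ∃ Q₀ : (W.baseChange K).toAffine.Point, ((2 ^ M₀ : ℕ) : ℤ) • Q₀ = y₀)
    (hndiv : ¬ ∃ Q₀ : (W.baseChange K).toAffine.Point, ((2 ^ (M₀ + 1) : ℕ) : ℤ) • Q₀ = y₀)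
    (n : ℕ) (d : KolyvaginHeegnerData Dt β ι n) (hn : Squarefree n)
    (hKoly : ∀ ℓ ∈ n.primeFactors, Zhang2014.IsKolyvaginPrime (W.conductorNorm ℤ) W K 2 ℓ)
    (hP : ¬ ∃ Q : (W.baseChange (ringClassField K ι n)).toAffine.Point, (2 : ℤ) • Q = d.derivedPoint) :
    Nat.card (AddCommGroup.primaryComponent (W.baseChange K).sha 2) = 2 ^ (2 * M₀) := by
  have h1 := (pow_smul_exact_derivedPoint_one_iff (p := 2) hK d₁ (by exact_mod_cast htors) hy₀ M₀).mpr
    ⟨hdiv, hndiv⟩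
  exact hX W hcm K hK hodd h3 hH hΔ₁ hΔ₂ hρ Dt β ι d₁ hy M₀ h1.1 h1.2 n d hn hKoly hP

/-- **Level one in the `E(K)`-currency: a `2`-primitive `y_K ∈ E(K)` kills `Ш(E/K)[2^∞]`** (modulo
Gross's Lemma 4.3 at `2`). Granted the crux (`hX`) and under its standing hypotheses, with NO
`2`-torsion in `E(K[1])` and `y₀ ∈ E(K)` over `P(1)`: if `y₀ ∉ 2E(K)` then `#Ш(E_K/K)[2^∞] = 1`.
(`M₀ = 0`, `n = 1`, `d = d₁`; the `E(K[1])`-certificate `P(1) ∉ 2E(K[1])` is obtained from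
`y₀ ∉ 2E(K)` by McCallum's Lemma 5.1.) This is the shape of W. Zhang-type `2`-primitivity
statements (`c(1) ≠ 0 ⟺ y_K ∉ 2E(K)`), the foreseen input of crux #6 `MinimalTwinBSDTwo`.
[cite: McCallumLMS1991, §5 Lemma 5.1 (p. 303) and §1 Theorem (Kolyvagin)] [cite: WZhang2014, Thm. 1.1 (shape)] -/
theorem card_sha_two_eq_one_of_kolyvaginExactAtTwo_indexCurrency (hX : KolyvaginExactAtTwo)
    (W : WeierstrassCurve ℚ) [W.IsElliptic] [W.IsGloballyMinimal] [NeZero (W.conductorNorm ℤ)]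
    (hcm : ¬ W.HasCM) (K : Type) [Field K] [NumberField K] (hK : IsImaginaryQuadratic K)
    (hodd : Odd (NumberField.discr K)) (h3 : NumberField.discr K ≠ -3)
    (hH : SatisfiesHeegnerHypothesis (W.conductorNorm ℤ) K)
    (hΔ₁ : ¬ IsSquare ((NumberField.discr K : ℚ) * -|W.Δ|))
    (hΔ₂ : ¬ IsSquare ((NumberField.discr K : ℚ) * (-(2 * |W.Δ|))))
    (hρ : ∀ n : ℕ, 0 < n → W.HasSurjectiveModNGaloisRep ((2 : ℤ) ^ n))
    (Dt : ModularParametrizationData W (W.conductorNorm ℤ)) (β : ℤ) (ι : K →+* ℂ)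
    (d₁ : KolyvaginHeegnerData Dt β ι 1) (hy : ¬ IsOfFinAddOrder d₁.derivedPoint)
    (htors : ∀ T : (W.baseChange (ringClassField K ι 1)).toAffine.Point, (2 : ℤ) • T = 0 → T = 0)
    {y₀ : (W.baseChange K).toAffine.Point}
    (hy₀ : WeierstrassCurve.Affine.Point.map (algebraMap K (ringClassField K ι 1)).toRatAlgHom y₀ =
      d₁.derivedPoint)
    (h2 : ¬ ∃ Q₀ : (W.baseChange K).toAffine.Point, (2 : ℤ) • Q₀ = y₀) :
    Nat.card (AddCommGroup.primaryComponent (W.baseChange K).sha 2) = 1 := by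
  have hdiv : ∃ Q₀ : (W.baseChange K).toAffine.Point, ((2 ^ 0 : ℕ) : ℤ) • Q₀ = y₀ :=
    ⟨y₀, by rw [pow_zero, Nat.cast_one, one_smul]⟩
  have hndiv : ¬ ∃ Q₀ : (W.baseChange K).toAffine.Point, ((2 ^ (0 + 1) : ℕ) : ℤ) • Q₀ = y₀ := by
    rwa [zero_add, pow_one, Nat.cast_ofNat]
  -- the `E(K[1])`-certificate at level one: `P(1) ∉ 2E(K[1])`
  have h1 := (pow_smul_exact_derivedPoint_one_iff (p := 2) hK d₁ (by exact_mod_cast htors) hy₀ 0).mpr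
    ⟨hdiv, hndiv⟩
  have hP : ¬ ∃ Q : (W.baseChange (ringClassField K ι 1)).toAffine.Point,
      (2 : ℤ) • Q = d₁.derivedPoint := by
    have h := h1.2
    rwa [zero_add, pow_one, Nat.cast_ofNat] at h
  have hKoly : ∀ ℓ ∈ (1 : ℕ).primeFactors,
      Zhang2014.IsKolyvaginPrime (W.conductorNorm ℤ) W K 2 ℓ := by
    intro ℓ hℓ
    rw [Nat.primeFactors_one] at hℓ
    exact absurd hℓ (Finset.notMem_empty ℓ)
  have h := hX W hcm K hK hodd h3 hH hΔ₁ hΔ₂ hρ Dt β ι d₁ hy 0 h1.1 h1.2 1 d₁ squarefree_one hKoly hP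
  rw [h, mul_zero, pow_zero]


/-! ## Append (same seat, same session): Gross's Lemma 4.3 at `2` IS a tree theorem — the hypothesis
`htors` of the two theorems above is discharged from the crux's own binders

Correction of the framing above: `E(K[n])[2] = 0` for a Heegner field of odd discriminant and a
curve with `E(ℚ)[2] = 0` is PROVED in the tree — cell «bsd-uniform», track U2,
`Summit.BirchSwinnertonDyer.Uniform.U2.RingClass.forall_two_nsmul_eq_zero_of_heegner`
(`Uniform/U2/RingClassNoTwoTorsion.lean`: from `E(ℚ)[2] = 0` alone, via the dihedral structure of
`Aut(K[n]/ℚ) ⊇ Gal(K[n]/K)`); and `E(ℚ)[2] = 0` follows from `ρ̄_{E,2}` onto (Dokchitser–Dokchitser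
2012 (1), tree theorem `DokchitserDokchitser2012.forall_two_nsmul_of_hasSurjectiveModNGaloisRep_two`),
which is the `n = 1` case of the crux's `2`-adic tower. So the `E(K)`-currency reading of the crux
needs NO hypothesis beyond the crux's own. -/

/-- **`E(K[1])[2] = 0` from the crux's binders** (`W` globally minimal with `ρ_{E,2^n}` onto for all
`n ≥ 1`, `K` imaginary quadratic of odd discriminant with the Heegner hypothesis for `N_E`): the
`n = 1` image hypothesis kills `E(ℚ)[2]` (Dokchitser–Dokchitser), and the bsd-uniform U2 theorem lifts
this to every ring class field of `K`. [cite: GrossLMS1991, §4 Lemma 4.3 (shape; here p = 2)]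
[cite: DokchitserDokchitserMathZ2012, Theorem (1)] -/
theorem ringClassField_one_two_torsion_eq_zero (W : WeierstrassCurve ℚ) [W.IsElliptic]
    [W.IsGloballyMinimal] (K : Type) [Field K] [NumberField K] (hK : IsImaginaryQuadratic K)
    (hodd : Odd (NumberField.discr K)) (hH : SatisfiesHeegnerHypothesis (W.conductorNorm ℤ) K)
    (hρ : ∀ n : ℕ, 0 < n → W.HasSurjectiveModNGaloisRep ((2 : ℤ) ^ n)) (ι : K →+* ℂ)
    (T : (W.baseChange (ringClassField K ι 1)).toAffine.Point) (hT : (2 : ℤ) • T = 0) : T = 0 := by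
  haveI := (finiteDimensional_and_isGalois_ringClassField hK ι one_ne_zero).1
  haveI : NumberField (ringClassField K ι 1) := NumberField.of_module_finite K _
  have hD4 : NumberField.discr K % 4 = 1 :=
    Literature.NumberTheory.QuadraticFields.Quadratic.discr_emod_four_eq_one hK.1 hodd
  have hρ2 : W.HasSurjectiveModNGaloisRep 2 := by simpa using hρ 1 one_pos
  -- the group law on `E(ℚ)` is stated with two (equal) `DecidableEq ℚ` instances in the two files
  have hQ : ∀ P : W.toAffine.Point, 2 • P = 0 → P = 0 := by
    intro P hP
    have h := DokchitserDokchitser2012.forall_two_nsmul_of_hasSurjectiveModNGaloisRep_two W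
      two_ne_zero hρ2 P (by convert hP)
    convert h
  refine Summit.BirchSwinnertonDyer.Uniform.U2.RingClass.forall_two_nsmul_eq_zero_of_heegner W hK ι
    hD4 hH hQ one_ne_zero T ?_
  rw [← natCast_zsmul]
  exact_mod_cast hT

/-- **`KolyvaginExactAtTwo` in the `E(K)`-currency, NO extra hypothesis** (the `htors` binder of
`card_sha_two_eq_of_kolyvaginExactAtTwo_indexCurrency` discharged by
`ringClassField_one_two_torsion_eq_zero`): granted the crux (`hX`) and under its standing hypotheses,
for `y₀ ∈ E(K)` over `P(1)` with `2^{M₀} ∣ y₀`, `2^{M₀+1} ∤ y₀` IN `E(K)` and a level-`n` certificate,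
`#Ш(E_K/K)[2^∞] = 2^{2M₀}`. [cite: McCallumLMS1991, §5 Lemma 5.1 (p. 303) and §1 Theorem (Kolyvagin)] -/
theorem card_sha_two_eq_of_kolyvaginExactAtTwo_indexCurrency' (hX : KolyvaginExactAtTwo)
    (W : WeierstrassCurve ℚ) [W.IsElliptic] [W.IsGloballyMinimal] [NeZero (W.conductorNorm ℤ)]
    (hcm : ¬ W.HasCM) (K : Type) [Field K] [NumberField K] (hK : IsImaginaryQuadratic K)
    (hodd : Odd (NumberField.discr K)) (h3 : NumberField.discr K ≠ -3)
    (hH : SatisfiesHeegnerHypothesis (W.conductorNorm ℤ) K)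
    (hΔ₁ : ¬ IsSquare ((NumberField.discr K : ℚ) * -|W.Δ|))
    (hΔ₂ : ¬ IsSquare ((NumberField.discr K : ℚ) * (-(2 * |W.Δ|))))
    (hρ : ∀ n : ℕ, 0 < n → W.HasSurjectiveModNGaloisRep ((2 : ℤ) ^ n))
    (Dt : ModularParametrizationData W (W.conductorNorm ℤ)) (β : ℤ) (ι : K →+* ℂ)
    (d₁ : KolyvaginHeegnerData Dt β ι 1) (hy : ¬ IsOfFinAddOrder d₁.derivedPoint)
    {y₀ : (W.baseChange K).toAffine.Point}
    (hy₀ : WeierstrassCurve.Affine.Point.map (algebraMap K (ringClassField K ι 1)).toRatAlgHom y₀ =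
      d₁.derivedPoint)
    (M₀ : ℕ) (hdiv : ∃ Q₀ : (W.baseChange K).toAffine.Point, ((2 ^ M₀ : ℕ) : ℤ) • Q₀ = y₀)
    (hndiv : ¬ ∃ Q₀ : (W.baseChange K).toAffine.Point, ((2 ^ (M₀ + 1) : ℕ) : ℤ) • Q₀ = y₀)
    (n : ℕ) (d : KolyvaginHeegnerData Dt β ι n) (hn : Squarefree n)
    (hKoly : ∀ ℓ ∈ n.primeFactors, Zhang2014.IsKolyvaginPrime (W.conductorNorm ℤ) W K 2 ℓ)
    (hP : ¬ ∃ Q : (W.baseChange (ringClassField K ι n)).toAffine.Point, (2 : ℤ) • Q = d.derivedPoint) :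
    Nat.card (AddCommGroup.primaryComponent (W.baseChange K).sha 2) = 2 ^ (2 * M₀) :=
  card_sha_two_eq_of_kolyvaginExactAtTwo_indexCurrency hX W hcm K hK hodd h3 hH hΔ₁ hΔ₂ hρ Dt β ι d₁ hy
    (ringClassField_one_two_torsion_eq_zero W K hK hodd hH hρ ι) hy₀ M₀ hdiv hndiv n d hn hKoly hP

/-- **Level one in the `E(K)`-currency, NO extra hypothesis**: granted the crux (`hX`) and under
its standing hypotheses, a `2`-PRIMITIVE `y_K ∈ E(K)` (`y₀ ∉ 2E(K)`) kills `Ш(E_K/K)[2^∞]`: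
`#Ш(E_K/K)[2^∞] = 1`. [cite: McCallumLMS1991, §5 Lemma 5.1 (p. 303) and §1 Theorem (Kolyvagin)] -/
theorem card_sha_two_eq_one_of_kolyvaginExactAtTwo_indexCurrency' (hX : KolyvaginExactAtTwo)
    (W : WeierstrassCurve ℚ) [W.IsElliptic] [W.IsGloballyMinimal] [NeZero (W.conductorNorm ℤ)]
    (hcm : ¬ W.HasCM) (K : Type) [Field K] [NumberField K] (hK : IsImaginaryQuadratic K)
    (hodd : Odd (NumberField.discr K)) (h3 : NumberField.discr K ≠ -3)
    (hH : SatisfiesHeegnerHypothesis (W.conductorNorm ℤ) K)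
    (hΔ₁ : ¬ IsSquare ((NumberField.discr K : ℚ) * -|W.Δ|))
    (hΔ₂ : ¬ IsSquare ((NumberField.discr K : ℚ) * (-(2 * |W.Δ|))))
    (hρ : ∀ n : ℕ, 0 < n → W.HasSurjectiveModNGaloisRep ((2 : ℤ) ^ n))
    (Dt : ModularParametrizationData W (W.conductorNorm ℤ)) (β : ℤ) (ι : K →+* ℂ)
    (d₁ : KolyvaginHeegnerData Dt β ι 1) (hy : ¬ IsOfFinAddOrder d₁.derivedPoint)
    {y₀ : (W.baseChange K).toAffine.Point}
    (hy₀ : WeierstrassCurve.Affine.Point.map (algebraMap K (ringClassField K ι 1)).toRatAlgHom y₀ =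
      d₁.derivedPoint)
    (h2 : ¬ ∃ Q₀ : (W.baseChange K).toAffine.Point, (2 : ℤ) • Q₀ = y₀) :
    Nat.card (AddCommGroup.primaryComponent (W.baseChange K).sha 2) = 1 :=
  card_sha_two_eq_one_of_kolyvaginExactAtTwo_indexCurrency hX W hcm K hK hodd h3 hH hΔ₁ hΔ₂ hρ Dt β ι
    d₁ hy (ringClassField_one_two_torsion_eq_zero W K hK hodd hH hρ ι) hy₀ h2

end Summit.BirchSwinnertonDyer.BirchSwinnertonDyer.Theorems

end
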